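import Literature.MathematicalPhysics.QuantumFieldTheory.Balaban1983to89.B9Thm311ReadingAtLetters

/-!
# `Balaban1983to89.B9Thm311AdjointAtLetters` — row 17 of the N06 knit ([B9] Theorem 3.11): the clauses «Q′\*(U) is the adjoint of
# Q′(U)» and «Q′\*(U) is injective» of the displayed schema `Inputs311Y` DISCHARGED at def-Y's letters under (3.35) («U is G-valued»)

T. Bałaban, *Propagators for lattice gauge theories in a background field*, Commun. Math. Phys. **99** (1985) 389–434
[`Balaban1985BackgroundPropagators`, "B9"]; [3] = *Propagators … I*, Commun. Math. Phys. **95** (1984) 17–40 [`Balaban1984PropagatorsI`];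
[4] = *Propagators … II*, Commun. Math. Phys. **96** (1984) 223–250 [`Balaban1984PropagatorsII`].

statement-level skeleton of published theorems with citation tags; proofs where landed; nothing here is a claim about the
Yang–Mills mass gap

THE PRINTED LOCI (verbatim).  p. 390, (3.1): *"R(U(x, x′))A = U(x, x′)AU(x, x′)⁻¹"*;  p. 393, (3.13)–(3.14) and (3.18)–(3.19) (the averaging
operators Q(U), Q\*(U) and their site analogues Q′(U), Q′\*(U), the distant argument parallel-transported along `Γ_{y,x}`);  p. 396, (3.35):
*"U(∂p) ∈ G"* with the values of U in the group G;  [3] p. 25: *"then Q′\*_kω = 0, hence ω = 0"*;  [4] (2.69) p. 235 (the block pairing).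

WHY THIS FILE.  `B9Thm311ReadingAtLetters` left every clause of the row-17 schema `Inputs311Y` displayed.  Two of them are not analytic
but ALGEBRAIC facts about def-Y's letters `QpY ∕ QpsY` (`trLiftY` of p21's `QM ∕ QsM` along the site transporters `parS U (corner y) z`):
(i) `adj` — Q′\*(U) is the adjoint of Q′(U) for site weight 1 and block weight `W` — holds as soon as the transporters are UNITARY
(`R(V)A = VAV⁻¹` with `V⁻¹ = V\*` preserves the trace pairing: `tr((R(V)A)\*B) = tr(A\*·R(V⁻¹)B)`) and `QsM(z, y) = W(y)·QM(y, z)`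
(`QsM_transpose`); at the letters of record the transporters are taxicab products of the values of U (`parSY_mem`), which (3.35) puts in
`G = SU(N) ⊂ U(N)`.  (ii) `qps_inj` — Q′\*(U)Ψ(z) = R(τ⁻¹)Ψ(y(z)) and every block contains its corner (`blkOf_corner`), so Q′\*(U) is
injective for EVERY U.  THIS FILE proves both and repackages row 17 at `opsYOfRecord` with the SEVEN remaining displayed clauses.

* §1 `val_inv_eq_conjTranspose`, ★ `trace_conjTranspose_R_mul` (unitary conjugation vs the trace pairing).
* §2 `wB_mul_qpK`, `QpsY_apply_eq`, ★ `qpsY_injective`, ★ `isAdjTr_QpY_QpsY` (unitary transporters), `isAdjTr_QpY_QpsY_of_mem`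
  (G-valued transporters, `G ≤ U(N)`), ★ `isAdjTr_QpY_QpsY_parSY` (def-Y's taxicab transporters, U G-valued).
* §3 `Inputs311Y₇` (pos0 symm0 unitA symmG posG0 fac small), ★ `inputs311Y_of_seven` (under «U is SU(N)-valued»), ★★ `t311_of_pins_opsYOfRecord₇`
  (row 17 at the letters of record from the pin `hPD` and the seven-clause schema; `adj`, `qps_inj` now THEOREMS, (3.35) read off `Reg335Body`).

HONEST SCOPE.  Finite-dimensional algebra and bookkeeping; the seven remaining clauses stay DISPLAYED hypotheses of printed shape (Δ′_a(U) > 0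
and symmetric, Δ_a(U) invertible, G(U) symmetric, G₀ > 0, (3.105)–(3.106), the L²-smallness of R).  LOCATED (R7, this seat, 2026-08-27): at
def-Y's v2 letters of record the two SYMMETRY clauses `symm0` ∕ `symmG` are NOT dischargeable for non-flat U — `OpsYDeltaPrimeA.avgTrY par U z w =
par U z c · par U c w` transports the corner value back to `z` along `U(Γ_{z,c})` where (3.24)'s `Q′_j(U)\*Q′_j(U)` uses `U(Γ_{c,z})⁻¹`, and the taxicab
table `parSY` is not inverse-symmetric (`U(Γ_{z,c})·U(Γ_{c,z})` = a plaquette holonomy in general), so def-Y's `deltaPrimeAY parSY U` is print's Δ′_a(U)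
only up to that holonomy and is not a symmetric operator; the faces below are generic in the letters and apply verbatim once the first factor of
`avgTrY` is inverted upstream.  Nothing of [B9] is asserted; NOT a node discharge, NOT summit progress; count-neutral; nothing continuum, nothing
about the mass gap.  Cell `pub-ymgap` (HUMAN RULING D-0062), Track A node N06 [B9], seat `pub-ymgap-dag-n06-j` (harness re-seat gen 6), 2026-08-27.
-/

namespace Literature.MathematicalPhysics.QuantumFieldTheory.Balaban1983to89.B9Thm311AdjointAtLetters

open Literature.MathematicalPhysics.QuantumFieldTheory.Balaban1983to89
open B9Thm311Whole B9Thm311ReadingCoords B9Thm311ReadingAtLetters Node00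
open B6KLevelCensusIndexV1 B6Ineq268MultiLevelBox B6Geom246MultiLevelBox B9PinMembersKLevelV1 B9PinGeometryKLevelV1
  B7Prop2SpecialUnitary
open scoped Matrix

noncomputable section

/-! ## §1 Unitary conjugation preserves the trace pairing -/

section Unitary

variable {n : Type} [Fintype n] [DecidableEq n]

/-- for a unitary unit `V` of `M_n(ℂ)`, `V⁻¹ = V\*`. [cite: Balaban1985BackgroundPropagators, (3.35) p.396 (U(∂p) ∈ G ⊂ U(N)), bookkeeping] -/
theorem val_inv_eq_conjTranspose (V : (Matrix n n ℂ)ˣ) (hV : (V : Matrix n n ℂ) ∈ unitary (Matrix n n ℂ)) :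
    ((V⁻¹ : (Matrix n n ℂ)ˣ) : Matrix n n ℂ) = (V : Matrix n n ℂ)ᴴ := by
  rw [← Matrix.star_eq_conjTranspose]
  exact Units.inv_eq_of_mul_eq_one_right (Unitary.mul_star_self_of_mem hV)

/-- ★ **THE ADJOINT ACTION `R(V)A = VAV⁻¹` BY A UNITARY PRESERVES THE TRACE PAIRING**: `tr((R(V)A)\* B) = tr(A\* · R(V⁻¹)B)` — the adjoint of
`R(V)` for `Re tr(A\*B)` is `R(V⁻¹)`. [cite: Balaban1985BackgroundPropagators, (3.1) p.390 + p.393 (scalar products)] -/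
theorem trace_conjTranspose_R_mul (V : (Matrix n n ℂ)ˣ) (hV : (V : Matrix n n ℂ) ∈ unitary (Matrix n n ℂ)) (A B : Matrix n n ℂ) :
    Matrix.trace ((B9Eq39Adjoint.R V A)ᴴ * B) = Matrix.trace (Aᴴ * B9Eq39Adjoint.R V⁻¹ B) := by
  unfold B9Eq39Adjoint.R
  rw [inv_inv, val_inv_eq_conjTranspose V hV, Matrix.conjTranspose_mul, Matrix.conjTranspose_mul,
    Matrix.conjTranspose_conjTranspose, Matrix.mul_assoc, Matrix.trace_mul_comm]
  simp only [Matrix.mul_assoc]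

end Unitary

/-! ## §2 `Q′\*(U)` is the `W`-adjoint of `Q′(U)` at unitary transporters, and is injective -/

section Averaging

open scoped Matrix.Norms.L2Operator

variable {d ℓ : ℕ} {hd : 1 ≤ d + 1} {hL : Odd (ℓ + 1) ∧ 1 < ℓ + 1} {b₀ b₁ : ℝ}
variable {N : ℕ} (i : KIdx d ℓ hd hL b₀ b₁)

/-- `W(y)·QM(y, z) = QsM(z, y)` — Q′\* is the `W`-weighted transpose of Q′ ([4] (2.69); `QsM_transpose`), entrywise on the Y carriers.
[cite: Balaban1984PropagatorsII, (2.69) p.235 + (2.16)–(2.17) p.225] -/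
theorem wB_mul_qpK (s : BlkY i) (z : SiteY i) : wB i s * qpK i s z = qpsK i z s := by
  change W i.D.toDomains s * B6Ineq288MultiLevelTorus.QM i.D s z = B6Ineq288MultiLevelTorus.QsM i.D z s
  unfold B6Ineq288MultiLevelTorus.QM B6Ineq288MultiLevelTorus.QsM
  split_ifs with h
  · rw [mul_inv_cancel₀ (W_pos _ s).ne']
  · rw [mul_zero]

/-- Q′\*(U), evaluated: `(Q′\*(U)Ψ)(z) = R(τ(y(z), z)⁻¹)Ψ(y(z))` with `y(z)` the block of `z` — the only block whose indicator meets `z`.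
[cite: Balaban1985BackgroundPropagators, (3.19) p.393; Balaban1984PropagatorsII, (2.16) p.225] -/
theorem QpsY_apply_eq (parS : SiteParY (Matrix (Fin N) (Fin N) ℂ) i) (U : CfgY (Matrix (Fin N) (Fin N) ℂ) i)
    (Ψ : BlkY i → Matrix (Fin N) (Fin N) ℂ) (z : SiteY i) :
    QpsY i parS U Ψ z = B9Eq39Adjoint.R (qpT i parS U (blkOf i.D.toDomains z) z)⁻¹ (Ψ (blkOf i.D.toDomains z)) := by
  rw [QpsY, trLiftY_apply]
  have hker : ∀ s : BlkY i, qpsK i z s = if blkOf i.D.toDomains z = s then 1 else 0 := fun s => rfl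
  simp_rw [hker]
  rw [Finset.sum_eq_single (blkOf i.D.toDomains z)]
  · simp
  · intro s _ hs
    rw [if_neg (Ne.symm hs)]
    simp
  · intro h
    exact absurd (Finset.mem_univ _) h

/-- ★ **Q′\*(U) IS INJECTIVE** for every U and every transporter table ([3] p. 25: *"then Q′\*_kω = 0, hence ω = 0"*): read `Q′\*(U)Ψ` at the
corner of each block (`blkOf_corner`) and undo the conjugation. [cite: Balaban1984PropagatorsI, p.25; Balaban1985BackgroundPropagators, (3.19) p.393] -/
theorem qpsY_injective (parS : SiteParY (Matrix (Fin N) (Fin N) ℂ) i) (U : CfgY (Matrix (Fin N) (Fin N) ℂ) i) :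
    Function.Injective (QpsY i parS U) := by
  rw [injective_iff_map_eq_zero]
  intro Ψ hΨ
  funext s
  have hz := congrFun hΨ (blkCornerY i s)
  rw [QpsY_apply_eq, Pi.zero_apply] at hz
  have hs : blkOf i.D.toDomains (blkCornerY i s) = s := blkOf_corner i.D.toDomains s
  rw [hs] at hz
  have := congrArg (B9Eq39Adjoint.R (qpT i parS U s (blkCornerY i s))) hz
  rwa [B9Eq39Adjoint.R_zero, ← B9Eq39Adjoint.R_mul, mul_inv_cancel, B9Eq39Adjoint.R_one] at this

/-- the trace pairing of a transported lift on the left: `Re tr((Σ_z M(y,z)•R(τ)Φ(z))\* B) = Σ_z M(y,z)·Re tr((R(τ)Φ(z))\* B)`.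
[cite: Balaban1985BackgroundPropagators, (3.18) p.393, bookkeeping] -/
theorem re_trace_conjTranspose_trLiftY_mul {X Y : Type} [Fintype X] (M : Matrix Y X ℝ) (T : Y → X → (Matrix (Fin N) (Fin N) ℂ)ˣ)
    (Φ : X → Matrix (Fin N) (Fin N) ℂ) (B : Matrix (Fin N) (Fin N) ℂ) (y : Y) :
    (Matrix.trace ((trLiftY M T Φ y)ᴴ * B)).re = ∑ z, M y z * (Matrix.trace ((B9Eq39Adjoint.R (T y z) (Φ z))ᴴ * B)).re := by
  rw [trLiftY_apply, Matrix.conjTranspose_sum, Finset.sum_mul, Matrix.trace_sum, Complex.re_sum]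
  refine Finset.sum_congr rfl fun z _ => ?_
  rw [Matrix.conjTranspose_smul, Matrix.smul_mul, Matrix.trace_smul, Complex.star_def, Complex.conj_ofReal, smul_eq_mul,
    Complex.re_ofReal_mul]

/-- the trace pairing of a transported lift on the right: `Re tr(A\* Σ_s M(z,s)•R(τ)Ψ(s)) = Σ_s M(z,s)·Re tr(A\* R(τ)Ψ(s))`.
[cite: Balaban1985BackgroundPropagators, (3.19) p.393, bookkeeping] -/
theorem re_trace_conjTranspose_mul_trLiftY {X Y : Type} [Fintype X] (M : Matrix Y X ℝ) (T : Y → X → (Matrix (Fin N) (Fin N) ℂ)ˣ)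
    (Ψ : X → Matrix (Fin N) (Fin N) ℂ) (A : Matrix (Fin N) (Fin N) ℂ) (y : Y) :
    (Matrix.trace (Aᴴ * trLiftY M T Ψ y)).re = ∑ s, M y s * (Matrix.trace (Aᴴ * B9Eq39Adjoint.R (T y s) (Ψ s))).re := by
  rw [trLiftY_apply, Matrix.mul_sum, Matrix.trace_sum, Complex.re_sum]
  refine Finset.sum_congr rfl fun s _ => ?_
  rw [Matrix.mul_smul, Matrix.trace_smul, smul_eq_mul, Complex.re_ofReal_mul]

/-- ★ **Q′\*(U) IS THE ADJOINT OF Q′(U)** for site weight 1 and block weight `W` whenever the site transporters `parS U (corner y) z` are UNITARY: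
`Σ_y W(y)·Re tr((Q′Φ)(y)\*Ψ(y)) = Σ_z Re tr(Φ(z)\*(Q′\*Ψ)(z))`. [cite: Balaban1985BackgroundPropagators, p.393 (3.18)–(3.19) (Q′, Q′* and the scalar products); Balaban1984PropagatorsII, (2.69) p.235] -/
theorem isAdjTr_QpY_QpsY (parS : SiteParY (Matrix (Fin N) (Fin N) ℂ) i) (U : CfgY (Matrix (Fin N) (Fin N) ℂ) i)
    (hpar : ∀ (s : BlkY i) (z : SiteY i), (parS U (blkCornerY i s) z : Matrix (Fin N) (Fin N) ℂ) ∈ unitary (Matrix (Fin N) (Fin N) ℂ)) :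
    IsAdjTr (fun _ => (1 : ℝ)) (wB i) (QpY i parS U) (QpsY i parS U) := by
  intro Φ Ψ
  rw [trIP_eq_re_trace, trIP_eq_re_trace]
  simp only [one_mul]
  have hL : ∀ s : BlkY i, wB i s * (Matrix.trace ((QpY i parS U Φ s)ᴴ * Ψ s)).re =
      ∑ z, qpsK i z s * (Matrix.trace ((Φ z)ᴴ * B9Eq39Adjoint.R (qpT i parS U s z)⁻¹ (Ψ s))).re := by
    intro s
    rw [QpY, re_trace_conjTranspose_trLiftY_mul, Finset.mul_sum]
    refine Finset.sum_congr rfl fun z _ => ?_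
    have hτ : ((qpT i parS U s z : (Matrix (Fin N) (Fin N) ℂ)ˣ) : Matrix (Fin N) (Fin N) ℂ) ∈ unitary (Matrix (Fin N) (Fin N) ℂ) :=
      hpar s z
    rw [← mul_assoc, wB_mul_qpK, trace_conjTranspose_R_mul _ hτ]
  have hR : ∀ z : SiteY i, (Matrix.trace ((Φ z)ᴴ * QpsY i parS U Ψ z)).re =
      ∑ s, qpsK i z s * (Matrix.trace ((Φ z)ᴴ * B9Eq39Adjoint.R (qpT i parS U s z)⁻¹ (Ψ s))).re := by
    intro z
    rw [QpsY, re_trace_conjTranspose_mul_trLiftY]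
  simp_rw [hL, hR]
  rw [Finset.sum_comm]

/-- the same for `G`-valued transporters with `G ≤ U(N)` (e.g. `G = SU(N)`: `specialUnitaryUnits_le_unitaryUnits`).
[cite: Balaban1985BackgroundPropagators, (3.35) p.396 (U(∂p) ∈ G) + p.393] -/
theorem isAdjTr_QpY_QpsY_of_mem {G : Subgroup (Matrix (Fin N) (Fin N) ℂ)ˣ} (hG : G ≤ B7Prop2Explicit.unitaryUnits (Matrix (Fin N) (Fin N) ℂ))
    (parS : SiteParY (Matrix (Fin N) (Fin N) ℂ) i) (U : CfgY (Matrix (Fin N) (Fin N) ℂ) i) (hpar : ∀ z z' : SiteY i, parS U z z' ∈ G) :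
    IsAdjTr (fun _ => (1 : ℝ)) (wB i) (QpY i parS U) (QpsY i parS U) :=
  isAdjTr_QpY_QpsY i parS U fun s z => hG (hpar (blkCornerY i s) z)

/-- ★ **AT def-Y's TAXICAB TRANSPORTERS `parSY`**: for a `G`-valued configuration, `G ≤ U(N)`, Q′\*(U) is the `W`-adjoint of Q′(U) (`parSY_mem`: taxicab
products of values of U stay in G). [cite: Balaban1985BackgroundPropagators, (3.35) p.396 + (3.40) p.397 (Γ_{z,z′}) + p.393] -/
theorem isAdjTr_QpY_QpsY_parSY {G : Subgroup (Matrix (Fin N) (Fin N) ℂ)ˣ} (hG : G ≤ B7Prop2Explicit.unitaryUnits (Matrix (Fin N) (Fin N) ℂ))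
    (U : CfgY (Matrix (Fin N) (Fin N) ℂ) i) (hU : ∀ μ x, U μ x ∈ G) :
    IsAdjTr (fun _ => (1 : ℝ)) (wB i) (QpY i (parSY i) U) (QpsY i (parSY i) U) :=
  isAdjTr_QpY_QpsY_of_mem i hG (parSY i) U fun z z' => parSY_mem i hU z z'

end Averaging

/-! ## §3 Row 17 at the letters of record with seven displayed clauses -/

section StageY

open scoped Matrix.Norms.L2Operator

variable {d ℓ : ℕ} {hd : 1 ≤ d + 1} {hL : Odd (ℓ + 1) ∧ 1 < ℓ + 1} {b₀ b₁ : ℝ} {Mstar : ℕ} {N : ℕ}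

/-- **THE SEVEN REMAINING DISPLAYED INPUTS** of the printed proof at def-Y's letters (the schema `Inputs311Y` minus `adj` and `qps_inj`, which are
theorems at the letters of record): Δ′_a(U) positive and symmetric, Δ_a(U) invertible, G(U) symmetric, G₀ positive, G₀ = G(I − R), ⟨Ψ, RΨ⟩ ≦ θ₁M⁻¹⟨Ψ, Ψ⟩.
Nothing asserted. [cite: Balaban1985BackgroundPropagators, Thm 3.11 proof p.416 + (3.24)–(3.27) pp.394–395 + (3.105)–(3.106) p.414] -/
structure Inputs311Y₇ (x : MemberY d ℓ hd hL b₀ b₁ Mstar) (𝔏 : CovLettersY (Matrix (Fin N) (Fin N) ℂ) x) (𝔔 : ProofLetters311 N x.toKIdx)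
    (θ₁ M : ℝ) (U : CfgY (Matrix (Fin N) (Fin N) ℂ) x.toKIdx) : Prop where
  pos0 : PosDefTr (fun _ => (1 : ℝ)) (deltaPrimeAY x.toKIdx 𝔏.parS U)
  symm0 : IsSymmTr (fun _ => (1 : ℝ)) (deltaPrimeAY x.toKIdx 𝔏.parS U)
  unitA : IsUnit (deltaAY x.toKIdx 𝔏.parS 𝔏.parB 𝔏.Gp U)
  symmG : IsSymmTr (fun _ => (1 : ℝ)) (𝔏.GA U)
  posG0 : PosDefTr (fun _ => (1 : ℝ)) (𝔔.G0 U)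
  fac : 𝔔.G0 U = 𝔏.GA U ∘ₗ (1 - 𝔔.R U)
  small : ∀ Ψ : FBondY x.toKIdx → Matrix (Fin N) (Fin N) ℂ,
    trIP (fun _ => (1 : ℝ)) Ψ (𝔔.R U Ψ) ≤ θ₁ * M⁻¹ * trIP (fun _ => (1 : ℝ)) Ψ Ψ

/-- ★ **NINE FROM SEVEN AT `G`-VALUED CONFIGURATIONS**: when the letters' site transporters are def-Y's taxicab `parSY` (`hparS`, `rfl` at `lettersYOfRecord`)
and U is `G`-valued with `G ≤ U(N)`, the clauses `adj` and `qps_inj` of `Inputs311Y` are supplied by `isAdjTr_QpY_QpsY_parSY` and `qpsY_injective`.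
[cite: Balaban1985BackgroundPropagators, (3.35) p.396 + p.393; Balaban1984PropagatorsI, p.25] -/
theorem inputs311Y_of_seven {G : Subgroup (Matrix (Fin N) (Fin N) ℂ)ˣ} (hG : G ≤ B7Prop2Explicit.unitaryUnits (Matrix (Fin N) (Fin N) ℂ))
    (x : MemberY d ℓ hd hL b₀ b₁ Mstar) (𝔏 : CovLettersY (Matrix (Fin N) (Fin N) ℂ) x) (𝔔 : ProofLetters311 N x.toKIdx)
    (hparS : 𝔏.parS = parSY x.toKIdx) {θ₁ M : ℝ} {U : CfgY (Matrix (Fin N) (Fin N) ℂ) x.toKIdx} (hU : ∀ μ z, U μ z ∈ G)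
    (h : Inputs311Y₇ x 𝔏 𝔔 θ₁ M U) : Inputs311Y x 𝔏 𝔔 θ₁ M U where
  pos0 := h.pos0
  symm0 := h.symm0
  adj := by rw [hparS]; exact isAdjTr_QpY_QpsY_parSY x.toKIdx hG U hU
  qps_inj := qpsY_injective x.toKIdx 𝔏.parS U
  unitA := h.unitA
  symmG := h.symmG
  posG0 := h.posG0
  fac := h.fac
  small := h.small

variable (θ : Stage3Params) (Mstar : ℕ) (𝔈 : ExpsY N θ Mstar)

/-- ★★ **ROW 17 AT THE LETTERS OF RECORD WITH SEVEN DISPLAYED CLAUSES**: at `opsYOfRecord N θ M⋆ 𝔈` the pin `hPD` and the seven-clause schema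
`Inputs311Y₇` under the provisos (M ≧ M₁, 0 < α₀, Mα₀ ≦ a₁, (3.35)) yield Theorem 3.11's printed predicate; «Q′\* = (Q′)\*» and «Q′\* injective» are
now THEOREMS — (3.35)'s «U is SU(N)-valued» is the first conjunct of `Reg335Body` at the member's own index.
[cite: Balaban1985BackgroundPropagators, Thm 3.11 p.416 + (3.35) p.396 + p.393; Balaban1984PropagatorsI, p.25] -/
theorem t311_of_pins_opsYOfRecord₇ (𝔔 : ∀ x : MemberY θ.d₆ θ.ℓ₆ θ.hd' θ.hL' θ.b₀ θ.b₁ Mstar, ProofLetters311 N x.toKIdx)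
    (θ₁ a₁ M₁ : ℝ) (ha₁ : 0 < a₁) (hM₁ : 0 < M₁)
    (h311 : ∀ x : MemberY θ.d₆ θ.ℓ₆ θ.hd' θ.hL' θ.b₀ θ.b₁ Mstar, M₁ ≤ (geo9Y x).M → ∀ α₀ : ℝ, 0 < α₀ → (geo9Y x).M * α₀ ≤ a₁ →
      ∀ U : (bg9Y (Matrix (Fin N) (Fin N) ℂ) (specialUnitaryUnits (Fin N)) x).Cfg,
        (bg9Y (Matrix (Fin N) (Fin N) ℂ) (specialUnitaryUnits (Fin N)) x).Reg335 c35Y α₀ U →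
          Inputs311Y₇ x (lettersYOfRecord N θ Mstar x) (𝔔 x) θ₁ (geo9Y x).M U)
    (hPD : ∀ x : MemberY θ.d₆ θ.ℓ₆ θ.hd' θ.hL' θ.b₀ θ.b₁ Mstar,
      ((opsYOfRecord N θ Mstar 𝔈) x).PosDef = PosDefOfOps (ops311Y x (lettersYOfRecord N θ Mstar x) (𝔔 x))) :
    B9.Thm311Printed c35Y geo9Y (bg9Y (Matrix (Fin N) (Fin N) ℂ) (specialUnitaryUnits (Fin N)))
      (fun x => ((opsYOfRecord N θ Mstar 𝔈) x).PosDef) :=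
  t311_of_pins_opsYOfRecord θ Mstar 𝔈 𝔔 θ₁ a₁ M₁ ha₁ hM₁
    (fun x hM α₀ hα₀ hMa U hU =>
      inputs311Y_of_seven specialUnitaryUnits_le_unitaryUnits x (lettersYOfRecord N θ Mstar x) (𝔔 x) rfl hU.1.1
        (h311 x hM α₀ hα₀ hMa U hU))
    hPD

end StageY

end

end Literature.MathematicalPhysics.QuantumFieldTheory.Balaban1983to89.B9Thm311AdjointAtLetters
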